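import Summits.QuantumFields.YangMills.Theses.SmallFieldWidening
import Literature.MathematicalPhysics.QuantumFieldTheory.Balaban1983to89.T3HistoryTailReduction
import Literature.MathematicalPhysics.QuantumFieldTheory.Balaban1983to89.T3ThresholdRemoval
import Literature.MathematicalPhysics.QuantumFieldTheory.Balaban1983to89.T3AveragedTailProfile

/-!
# Route `SmallFieldWidening` — crux r3 `LargeFieldMassRefinementTail` (stmt-QuantumFields-22884) FOLLOWS FROM THE NEIGHBOURING ROUTE's
# K2 PER-HEIGHT ESTIMATE FOR ONE FIXED FAMILY: no cut-off-uniform, volume-uniform or coupling-uniform constants are needed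
# (support file; width seat `ym-line-sfw-p2-w2`, line `birth` v2 of lead `ym-line-sfw-p2`)

THE OBSERVATION.  The crux asks, for a family `F` and a coupling `γ`, for ONE null sequence `δ n → 0` bounding, for every refinement
depth `n` (family `F.refine n`, coupling `γL^{-n} ≤ γ₁`) and EVERY run `K`, the Gibbs mass of the complement of the all-heights
small-field event `histGood (F.refine n) … K 0`.  But run `K` of `F.refine n` at `γL^{-n}` IS run `n + K` of `F` at `γ` — same finest
lattice, same Wilson weight (tree `T3ThresholdRemoval.integral_gibbsMeasure_comp_fieldShift`, `T3Family.refine_β`), the block averagings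
correspond level by level (tree `T3LevelShift.iter_fieldShift`), and the thresholds shift: `θ_{γL^{-n}}(i) = θ_γ(i + n)` — so that event is
Bałaban's UV-small-history event of run `n + K` of `F` WITH `n` FREE TOP STEPS, `histGood F … (K + n) n` (§1, `gibbsK_refine_real_compl_histGood`).
Hence a per-height large-field profile `q` for the ONE family `F.refine n₀` at `γL^{-n₀} ≤ γ₁` (`n₀` the least admissible depth;
`T3CruxEstimates.HeightTailAt`: `Gibbs_{K'}{¬PlaqSmall θ(K'−j) (Ū^{j})} ≤ q(K'−j)`, `Σ q < ∞`) gives, by the union bound over the constrained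
heights (tree `T3HistoryTailReduction.real_compl_histGood_le_sum`), `mass(n, K) ≤ Σ_{i ≥ n − n₀} q(i) =: δ n → 0` UNIFORMLY IN `K` (§2, §3).

CONSEQUENCES (§3).  `largeFieldMassRefinementTail_of_heightTail`: the crux BY NAME from the K2-estimate package of route `UnitScaleTilt`
(hypothesis `h2` of `T3CruxEstimates.continuumYM3Torus_of_heightEstimates`); `…_of_averagedTail`: from the block-AVERAGED heights alone
(hypothesis of the landed `unitScaleTilt_historyTail_of_averagedTail`; the bare height is the theorem `T3BareTailProfile.bareTailAt`);
`…_of_perPlaquette`: from the PER-PLAQUETTE schema with constants depending on `(F, γ)` (`T3AveragedTailProfile.averagedTailAt_of_perPlaquette`,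
the currency of crux `HistoryTail` stmt-QuantumFields-18916); `…_of_uniformPerPlaquette`: a fortiori from the line's registered stub
`stub_perPlaquetteTail` ALONE (its uniform prefix is not needed; the skeleton's stubs `stub_massOfPerPlaquette`, `stub_seriesTail` are bypassed).
The companion file `…OfHistoryTailStubs` derives the crux modulo EXACTLY the two registered stubs of crux `HistoryTail` (stmt-QuantumFields-18916).

WHAT THIS IS NOT: no large-field estimate is proved here — the per-height / per-plaquette tail of the block-averaged `SU(2)` fields is the
located, unprinted renormalisation-group content ([Balaban1985UV3] (71) p.273 prints the factor per large plaquette inside the densities);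
nothing here bears on the Yang–Mills mass gap (rung R3 record only).

References: T. Bałaban, CMP 102 (1985) 255–275 [Balaban1985UV3] ((1)–(3) p.256, (7) p.257, (71) p.273); C. King, CMP 102 (1986) 649–677
[King1986] (Thm 3.4 (3.9)–(3.13)).
-/

noncomputable section

open MeasureTheory Filter Topology
open Literature.MathematicalPhysics.QuantumFieldTheory.Balaban1983to89
open Literature.MathematicalPhysics.QuantumFieldTheory.Balaban1983to89.T3ContinuumYM3Torus
open Literature.MathematicalPhysics.QuantumFieldTheory.Balaban1983to89.T3UnitScaleTilt
open Literature.MathematicalPhysics.QuantumFieldTheory.Balaban1983to89.T3UnitLawDensityEML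
open Literature.MathematicalPhysics.QuantumFieldTheory.Balaban1983to89.T3LevelShift
open Literature.MathematicalPhysics.QuantumFieldTheory.Balaban1983to89.T3ThresholdRemoval
open Literature.MathematicalPhysics.QuantumFieldTheory.Balaban1983to89.T3HistoryTailReduction
open Literature.MathematicalPhysics.QuantumFieldTheory.Balaban1983to89.T3CruxEstimates
open Literature.MathematicalPhysics.QuantumFieldTheory.Balaban1983to89.T3BareTailProfile
open Literature.MathematicalPhysics.QuantumFieldTheory.Balaban1983to89.T3AveragedTailProfile

namespace Summit.QuantumFields.YangMills.Theorems.LargeFieldMassRefinementTailOfHeightTail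

/-! ## §1 Run `K` of the refined family is run `K + d` of the original with `d` free top steps -/

section Transport

variable (F : T3Family) {G : Type*} [GaugeGroup G]

/-- The thresholds shift under refinement: `θ_{L, γL^{-d}}(i) = θ_{L, γ}(i + d)` (`θ(i) = g_i p(g_i)`, `g_i = √(γL^{-i})`).
[cite: Balaban1985UV3, (3) p.256 and (7) p.257] -/
theorem θBal_mul_pow (L : ℕ) (γ b₀ p₀ : ℝ) (d i : ℕ) :
    θBal L (γ * ((L : ℝ)⁻¹) ^ d) b₀ p₀ i = θBal L γ b₀ p₀ (i + d) := by
  unfold θBal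
  rw [show γ * ((L : ℝ)⁻¹) ^ d * ((L : ℝ)⁻¹) ^ i = γ * ((L : ℝ)⁻¹) ^ (i + d) by rw [pow_add]; ring]

/-- The small-field event is invariant under the level identification of two towers (plaquettes correspond, `plaqShift`).
[cite: Balaban1987RG1, (0.18) p.255] -/
theorem plaqSmall_fieldShift_iff {m K j m' K' j' : ℕ} (h : (F.PP m K).sitesPerDir j = (F.PP m' K').sitesPerDir j') (δ : ℝ)
    (V : GaugeField (F.PP m' K') j' G) : PlaqSmall δ (fieldShift h V) ↔ PlaqSmall δ V := by
  unfold PlaqSmall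
  simp_rw [plaqHol_fieldShift h V]
  refine ⟨fun hV p => ?_, fun hV p => hV _⟩
  have hp := hV ((plaqShift h).symm p)
  rwa [Equiv.apply_symm_apply] at hp

variable (ℰ : LoopAverage G)

/-- **THE EVENT IDENTIFICATION**: read on the original family's run `K + d` (finest lattices agree, `sitesPerDir_refine_zero`), the
all-heights small-field event of run `K` of `F.refine d` at the shifted thresholds `θ(· + d)` is the UV-small-history event of run `K + d`
of `F` with `d` FREE TOP STEPS. [cite: Balaban1985UV3, (7) p.257] -/
theorem fieldShift_mem_histGood_iff (θ : ℕ → ℝ) (d K : ℕ) (U : GaugeField ((F.refine d).P K) 0 G) :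
    fieldShift (sitesPerDir_refine_zero F d K) U ∈ histGood F ℰ θ (K + d) d ↔
      U ∈ histGood (F.refine d) ℰ (fun i => θ (i + d)) K 0 := by
  have hmK : F.m + (K + d) = F.m + d + K := by omega
  simp only [histGood, Set.mem_setOf_eq]
  constructor
  · intro h j hj
    have hj' : j ≤ K := by omega
    have hjd := h j (by omega)
    have key := iter_fieldShift ℰ hmK j U
    erw [key, plaqSmall_fieldShift_iff] at hjd
    rw [show K + d - j = K - j + d by omega] at hjd
    exact hjd
  · intro h j hj
    have hj' : j ≤ K := by omega
    have hjd := h j (by omega)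
    have key := iter_fieldShift ℰ hmK j U
    erw [key, plaqSmall_fieldShift_iff]
    rw [show K + d - j = K - j + d by omega]
    exact hjd

variable [MeasurableSpace G] [HaarData G] [RegularGaugeGroup G]

/-- **THE MASS IDENTIFICATION**: the Gibbs mass (run `K` of `F.refine d` at `γL^{-d}`) of the complement of the all-heights small-field
event at thresholds `θ(· + d)` EQUALS the Gibbs mass (run `K + d` of `F` at `γ`) of the complement of the UV-small-history event with `d`
free top steps at thresholds `θ` — same lattice, same Wilson weight `β'_K = β_{K+d}`, product Haar measures and block averagings
corresponding under `fieldShift`. [cite: Balaban1985UV3, (1)-(3) p.256 and (7) p.257] -/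
theorem gibbsK_refine_real_compl_histGood (hE : ℰ.MeasurableE) {γ : ℝ} (hγ : 0 ≤ γ) (θ : ℕ → ℝ) (d K : ℕ) :
    (gibbsK (F.refine d) ℰ (γ * ((F.L : ℝ)⁻¹) ^ d) K).real (histGood (F.refine d) ℰ (fun i => θ (i + d)) K 0)ᶜ =
      (gibbsK F ℰ γ (K + d)).real (histGood F ℰ θ (K + d) d)ᶜ := by
  have hβ : ((F.refine d).scheme ℰ (γ * ((F.L : ℝ)⁻¹) ^ d)).β K = (F.scheme ℰ γ).β (K + d) := F.refine_β ℰ γ d K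
  have hβ0 : 0 ≤ (F.scheme ℰ γ).β (K + d) := F.scheme_β_nonneg ℰ hγ (K + d)
  have hSA : MeasurableSet (histGood (F.refine d) ℰ (fun i => θ (i + d)) K 0)ᶜ :=
    (measurableSet_histGood (F.refine d) ℰ hE _ K 0).compl
  have hSB : MeasurableSet (histGood F ℰ θ (K + d) d)ᶜ := (measurableSet_histGood F ℰ hE θ (K + d) d).compl
  have key := integral_gibbsMeasure_comp_fieldShift (G := G) (sitesPerDir_refine_zero F d K) hβ0
    ((histGood F ℰ θ (K + d) d)ᶜ.indicator 1)
  have hind : (fun V : GaugeField ((F.refine d).P K) 0 G =>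
      (histGood F ℰ θ (K + d) d)ᶜ.indicator (1 : GaugeField (F.P (K + d)) 0 G → ℝ)
        (fieldShift (sitesPerDir_refine_zero F d K) V)) =
      (histGood (F.refine d) ℰ (fun i => θ (i + d)) K 0)ᶜ.indicator 1 := by
    funext V
    by_cases hV : fieldShift (sitesPerDir_refine_zero F d K) V ∈ histGood F ℰ θ (K + d) d
    · have hV' : V ∈ histGood (F.refine d) ℰ (fun i => θ (i + d)) K 0 := (fieldShift_mem_histGood_iff F ℰ θ d K V).mp hV
      erw [Set.indicator_of_notMem (Set.notMem_compl_iff.mpr hV), Set.indicator_of_notMem (Set.notMem_compl_iff.mpr hV')]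
    · have hV' : V ∉ histGood (F.refine d) ℰ (fun i => θ (i + d)) K 0 :=
        fun h' => hV ((fieldShift_mem_histGood_iff F ℰ θ d K V).mpr h')
      erw [Set.indicator_of_mem (Set.mem_compl hV), Set.indicator_of_mem (Set.mem_compl hV')]
      rfl
  erw [hind, integral_indicator_one hSA, integral_indicator_one hSB] at key
  rw [gibbsK_eq, gibbsK_eq, hβ]
  exact key

end Transport

/-! ## §2 The core estimate: a per-height profile of ONE family bounds every run of every refinement, by the tail of the profile -/

section Core

/-- **K-UNIFORM MASS BOUND FROM A PER-HEIGHT PROFILE**: if the per-height large-field Gibbs probabilities of the family `F` at coupling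
`γ ≥ 0` are bounded by `q(K' − j)` (`q ≥ 0` summable; the `htail` clause of `HeightTailAt`), then for every refinement depth `d` and
EVERY run `K` the Gibbs mass (family `F.refine d`, coupling `γL^{-d}`) of the complement of the all-heights small-field event is at most
the tail `Σ'_t q(t + d)` — union bound over the heights `j ≤ K` of run `K + d` of `F`, at distances `K + d − j ≥ d` from the unit scale.
[cite: Balaban1985UV3, (7) p.257 and (71) p.273] -/
theorem gibbsK_refine_real_compl_histGood_le_tsum (F : T3Family) {γ : ℝ} (hγ : 0 ≤ γ) (b₀ p₀ : ℝ) {q : ℕ → ℝ}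
    (hq0 : ∀ i, 0 ≤ q i) (hq : Summable q)
    (htail : ∀ K j, j ≤ K → (gibbsK F ℰp γ K).real
      {U | ¬ PlaqSmall (θBal F.L γ b₀ p₀ (K - j))
        (Averaging.iter (fun i => BlockAveraging.blockAvg (P := F.P K) (j := i) ℰp) j U)} ≤ q (K - j))
    (d K : ℕ) :
    (gibbsK (F.refine d) ℰp (γ * ((F.L : ℝ)⁻¹) ^ d) K).real
        (histGood (F.refine d) ℰp (θBal (F.refine d).L (γ * ((F.L : ℝ)⁻¹) ^ d) b₀ p₀) K 0)ᶜ ≤ ∑' t, q (t + d) := by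
  have hθ : θBal (F.refine d).L (γ * ((F.L : ℝ)⁻¹) ^ d) b₀ p₀ = fun i => θBal F.L γ b₀ p₀ (i + d) :=
    funext fun i => θBal_mul_pow F.L γ b₀ p₀ d i
  rw [hθ, gibbsK_refine_real_compl_histGood F ℰp measurableE_ℰp hγ (θBal F.L γ b₀ p₀) d K]
  haveI := isProbabilityMeasure_gibbsK F ℰp hγ (K + d)
  refine (real_compl_histGood_le_sum F ℰp (θBal F.L γ b₀ p₀) (K + d) d (gibbsK F ℰp γ (K + d))).trans ?_
  rw [Nat.add_sub_cancel]
  have hrefl : ∑ j ∈ Finset.range (K + 1), q (K + d - j) = ∑ t ∈ Finset.range (K + 1), q (t + d) := by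
    rw [← Finset.sum_range_reflect (fun t => q (t + d)) (K + 1)]
    refine Finset.sum_congr rfl fun j hj => ?_
    rw [Finset.mem_range] at hj
    congr 1
    omega
  calc ∑ j ∈ Finset.range (K + 1), (gibbsK F ℰp γ (K + d)).real
          {U | ¬ PlaqSmall (θBal F.L γ b₀ p₀ (K + d - j))
            (Averaging.iter (fun i => BlockAveraging.blockAvg (P := F.P (K + d)) (j := i) ℰp) j U)}
      ≤ ∑ j ∈ Finset.range (K + 1), q (K + d - j) :=
        Finset.sum_le_sum fun j hj => htail (K + d) j (by have := Finset.mem_range.mp hj; omega)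
    _ = ∑ t ∈ Finset.range (K + 1), q (t + d) := hrefl
    _ ≤ ∑' t, q (t + d) := ((summable_nat_add_iff d).mpr hq).sum_le_tsum _ fun t _ => hq0 _

/-- Refinements compose: `(F.refine a).refine b = F.refine (a + b)`. [cite: Balaban1985UV3, (1)-(3) p.256] -/
theorem refine_refine (F : T3Family) (a b : ℕ) : (F.refine a).refine b = F.refine (a + b) := by
  simp only [T3Family.refine, Nat.add_assoc]

/-- **ONE NULL SEQUENCE FOR ALL RUNS OF ALL ADMISSIBLE REFINEMENTS**: for a family `F` and `γ > 0`, if every admissible refinement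
(`γL^{-n} ≤ γ₁`) carries K2's per-height estimate `HeightTailAt`, then there is `δ n → 0` bounding the complement masses of the all-heights
events of every run `K` of `F.refine n`, `γL^{-n} ≤ γ₁` — `δ n = Σ_{i ≥ n − n₀} q(i)` for the profile `q` of the LEAST admissible depth
`n₀` (only that one instance of the hypothesis is used). [cite: Balaban1985UV3, (7) p.257 and (71) p.273] -/
theorem exists_null_mass_bound (F : T3Family) {γ γ₁ b₀ p₀ : ℝ} (hγ : 0 < γ)
    (H : ∀ n : ℕ, γ * ((F.L : ℝ)⁻¹) ^ n ≤ γ₁ → HeightTailAt (F.refine n) (γ * ((F.L : ℝ)⁻¹) ^ n) b₀ p₀) :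
    ∃ δ : ℕ → ℝ, Tendsto δ atTop (𝓝 0) ∧ ∀ n K : ℕ, γ * ((F.L : ℝ)⁻¹) ^ n ≤ γ₁ →
      (gibbsK (F.refine n) ℰp (γ * ((F.L : ℝ)⁻¹) ^ n) K).real
        (histGood (F.refine n) ℰp (θBal (F.refine n).L (γ * ((F.L : ℝ)⁻¹) ^ n) b₀ p₀) K 0)ᶜ ≤ δ n := by
  classical
  by_cases hex : ∃ n : ℕ, γ * ((F.L : ℝ)⁻¹) ^ n ≤ γ₁
  · have hn₀ : γ * ((F.L : ℝ)⁻¹) ^ Nat.find hex ≤ γ₁ := Nat.find_spec hex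
    obtain ⟨q, hq0, hq, -, htail⟩ := H (Nat.find hex) hn₀
    have hL0 : (0 : ℝ) < F.L := by exact_mod_cast (zero_lt_one.trans F.hL.2)
    have hγ' : 0 ≤ γ * ((F.L : ℝ)⁻¹) ^ Nat.find hex := (mul_pos hγ (pow_pos (inv_pos.mpr hL0) _)).le
    refine ⟨fun n => ∑' t, q (t + (n - Nat.find hex)), ?_, fun n K hle => ?_⟩
    · exact (tendsto_sum_nat_add q).comp (tendsto_sub_atTop_nat (Nat.find hex))
    · have hn : Nat.find hex ≤ n := Nat.find_min' hex hle
      obtain ⟨d, rfl⟩ : ∃ d, n = Nat.find hex + d := ⟨n - Nat.find hex, by omega⟩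
      have hd : Nat.find hex + d - Nat.find hex = d := Nat.add_sub_cancel_left _ _
      have hc : γ * ((F.L : ℝ)⁻¹) ^ (Nat.find hex + d) =
          γ * ((F.L : ℝ)⁻¹) ^ Nat.find hex * ((F.L : ℝ)⁻¹) ^ d := by rw [pow_add, mul_assoc]
      beta_reduce
      rw [hd, hc, ← refine_refine F (Nat.find hex) d]
      exact gibbsK_refine_real_compl_histGood_le_tsum (F.refine (Nat.find hex)) hγ' b₀ p₀ hq0 hq htail d K
  · exact ⟨fun _ => 0, tendsto_const_nhds, fun n K hle => (hex ⟨n, hle⟩).elim⟩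

end Core

/-! ## §3 The crux BY NAME from the K2 currencies of route `UnitScaleTilt` -/

section Crux

/-- **r3 ⇐ K2's PER-HEIGHT ESTIMATE** (the package `∀ L, ∃ (b₀, p₀, γ₁), ∀ F (F.L = L) ∀ 0 < γ ≤ γ₁, HeightTailAt F γ b₀ p₀` = hypothesis
`h2` of `T3CruxEstimates.continuumYM3Torus_of_heightEstimates`): `LargeFieldMassRefinementTail` holds.  No uniformity of the profile in the
family or the coupling is used. [cite: Balaban1985UV3, (7) p.257 and (71) p.273] -/
theorem largeFieldMassRefinementTail_of_heightTail
    (h : ∀ L : ℕ, ∃ b₀ p₀ γ₁ : ℝ, 0 < b₀ ∧ 2 < p₀ ∧ 0 < γ₁ ∧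
      ∀ (F : T3Family) (γ : ℝ), F.L = L → 0 < γ → γ ≤ γ₁ → HeightTailAt F γ b₀ p₀) :
    Summit.QuantumFields.YangMills.Theses.SmallFieldWidening.LargeFieldMassRefinementTail := by
  intro L
  obtain ⟨b₀, p₀, γ₁, hb₀, hp₀, hγ₁, H⟩ := h L
  refine ⟨b₀, p₀, γ₁, hb₀, hp₀, hγ₁, fun F γ hFL hγ => ?_⟩
  have hL0 : (0 : ℝ) < F.L := by exact_mod_cast (zero_lt_one.trans F.hL.2)
  exact exists_null_mass_bound F hγ fun n hn =>
    H (F.refine n) _ hFL (mul_pos hγ (pow_pos (inv_pos.mpr hL0) n)) hn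

/-- **r3 ⇐ THE BLOCK-AVERAGED HEIGHTS ALONE** (the package of the landed `unitScaleTilt_historyTail_of_averagedTail`: `∀ L, ∃ (b₀, p₀),
∃ γ₁ ≤ 1, ∀ F (F.L = L) ∀ 0 < γ ≤ γ₁, AveragedTailAt F γ b₀ p₀`; the bare height is the theorem `T3BareTailProfile.bareTailAt`).
[cite: Balaban1985UV3, (71) p.273] -/
theorem largeFieldMassRefinementTail_of_averagedTail
    (h : ∀ L : ℕ, ∃ b₀ p₀ γ₁ : ℝ, 0 < b₀ ∧ 2 < p₀ ∧ 0 < γ₁ ∧ γ₁ ≤ 1 ∧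
      ∀ (F : T3Family) (γ : ℝ), F.L = L → 0 < γ → γ ≤ γ₁ → AveragedTailAt F γ b₀ p₀) :
    Summit.QuantumFields.YangMills.Theses.SmallFieldWidening.LargeFieldMassRefinementTail :=
  largeFieldMassRefinementTail_of_heightTail fun L => by
    obtain ⟨b₀, p₀, γ₁, hb, hp, hγ₁, hγ₁1, h⟩ := h L
    exact ⟨b₀, p₀, γ₁, hb, hp, hγ₁, fun F γ hFL hγ hle =>
      (heightTailAt_iff_averagedTailAt F hγ (hle.trans hγ₁1) hb (by linarith)).mpr (h F γ hFL hγ hle)⟩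

/-- **r3 ⇐ A PER-PLAQUETTE TAIL WITH CONSTANTS DEPENDING ON THE FAMILY AND THE COUPLING** — the currency of crux `HistoryTail`
(stmt-QuantumFields-18916) of route `UnitScaleTilt` (`T3AveragedTailProfile.averagedTailAt_of_perPlaquette`): for every `L` a profile and a
threshold `γ₁ ≤ 1` such that every `F` with `F.L = L` and every `0 < γ ≤ γ₁` admit `C(F,γ) ≥ 0`, `A(F,γ)`, `c(F,γ) > 0` with
`Gibbs_K{θ(K−j) ≤ |Ū^{j}(∂p) − 1|} ≤ C·β_{K−j}^A·e^{−c·p(g_{K−j})²}` for all `K`, `1 ≤ j ≤ K`, `p`. [cite: Balaban1985UV3, (71) p.273] -/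
theorem largeFieldMassRefinementTail_of_perPlaquette
    (h : ∀ L : ℕ, ∃ b₀ p₀ γ₁ : ℝ, 0 < b₀ ∧ 2 < p₀ ∧ 0 < γ₁ ∧ γ₁ ≤ 1 ∧
      ∀ (F : T3Family) (γ : ℝ), F.L = L → 0 < γ → γ ≤ γ₁ →
        ∃ (C : ℝ) (A : ℕ) (c : ℝ), 0 ≤ C ∧ 0 < c ∧
          ∀ (K j : ℕ), 1 ≤ j → j ≤ K → ∀ p : Plaq (F.P K) j,
            (gibbsK F ℰp γ K).real
                {U | θBal F.L γ b₀ p₀ (K - j) ≤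
                  GaugeGroup.dist1 (GaugeField.plaqHol
                    (Averaging.iter (fun i => BlockAveraging.blockAvg (P := F.P K) (j := i) ℰp) j U) p)} ≤
              C * (F.scheme ℰp γ).β (K - j) ^ A *
                Real.exp (-(c * B10.pFun b₀ p₀ (Real.sqrt (γ * ((F.L : ℝ)⁻¹) ^ (K - j))) ^ 2))) :
    Summit.QuantumFields.YangMills.Theses.SmallFieldWidening.LargeFieldMassRefinementTail :=
  largeFieldMassRefinementTail_of_averagedTail fun L => by
    obtain ⟨b₀, p₀, γ₁, hb, hp, hγ₁, hγ₁1, h⟩ := h L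
    exact ⟨b₀, p₀, γ₁, hb, hp, hγ₁, hγ₁1, fun F γ hFL hγ hle =>
      averagedTailAt_of_perPlaquette F hγ (hle.trans hγ₁1) hb (by linarith) (h F γ hFL hγ hle)⟩

/-- **r3 ⇐ THE LINE's STUB `stub_perPlaquetteTail` ALONE** (registered text of skeleton v2, constants uniform in the family and the
coupling — a fortiori): the skeleton's bookkeeping and series stubs are not needed for the crux. [cite: Balaban1985UV3, (71) p.273] -/
theorem largeFieldMassRefinementTail_of_uniformPerPlaquette
    (h : ∀ (L : ℕ), ∃ (b₀ p₀ γ₁ C c : ℝ) (A : ℕ), 0 < b₀ ∧ 2 < p₀ ∧ 0 < γ₁ ∧ γ₁ ≤ 1 ∧ 0 ≤ C ∧ 0 < c ∧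
      ∀ (F : T3Family) (γ : ℝ), F.L = L → 0 < γ → γ ≤ γ₁ →
        ∀ (K j : ℕ), 1 ≤ j → j ≤ K → ∀ p : Plaq (F.P K) j,
          (gibbsK F ℰp γ K).real
              {U | θBal F.L γ b₀ p₀ (K - j) ≤
                GaugeGroup.dist1 (GaugeField.plaqHol
                  (Averaging.iter (fun i => BlockAveraging.blockAvg (P := F.P K) (j := i) ℰp) j U) p)} ≤
            C * (F.scheme ℰp γ).β (K - j) ^ A *
              Real.exp (-(c * B10.pFun b₀ p₀ (Real.sqrt (γ * ((F.L : ℝ)⁻¹) ^ (K - j))) ^ 2))) :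
    Summit.QuantumFields.YangMills.Theses.SmallFieldWidening.LargeFieldMassRefinementTail :=
  largeFieldMassRefinementTail_of_perPlaquette fun L => by
    obtain ⟨b₀, p₀, γ₁, C, c, A, hb, hp, hγ₁, hγ₁1, hC, hc, h⟩ := h L
    exact ⟨b₀, p₀, γ₁, hb, hp, hγ₁, hγ₁1, fun F γ hFL hγ hle => ⟨C, A, c, hC, hc, h F γ hFL hγ hle⟩⟩

end Crux

end Summit.QuantumFields.YangMills.Theorems.LargeFieldMassRefinementTailOfHeightTail

end
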